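import Summits.QuantumFields.BalabanUV.T4Continuum.Support.RegionStarTrace
import Summits.QuantumFields.BalabanUV.T4Continuum.Support.RegionSliceCoerciveBox

/-!
# T⁴ programme, spine node NE2 (U1a), sub-row Δ1 «NE2⁰-Dirichlet» — THE TRACE INEQUALITY ON THE OUTWARD SPIKES AND THE EXTERIOR FLUX OF A
# STAR-BOND FIELD: `extFlux A ≤ 4d·n·(2·nsq A + Σ_ν nsq (igrad_ν A))` on ANY union of blocks (file 1 of 2 of «Δ1-VEC-W2-LINEAR-BOX»; file 2
# `RegionStarGradientLinearBox` puts the zero-extension gradient energy in the linear-growth class on boxes and discharges the W2 binder of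
# the COMPRESSED star tower `DirichletStarVectorTower.towerLimitRate_star_of_linear`)

NE2 formalisation swarm `b2b-balaban-t4-ne2-formalise-*`, LEAF PROVER 06 (gen 6), item 2 «Δ1-VEC-W2-LINEAR-BOX» (journal 2026-08-20
l.21157), on this seat's `Support/RegionStarTrace` (the trace inequality on the INWARD spikes `trace_deficient_le`), leaf-07-g6's
`Support/RegionGaffneyIdentity` (`gaffney_region : ‖curlR A‖² + ‖∂_ΩᴴA‖² + extFlux A = Σ_ν ‖∇_ν ιA‖²`), leaf-07-g7's `Support/RegionInteriorW2`
(`nsq_eq_add`, `nsq_gaugeP_div_le`, `interiorW2_of_slice`, `CgIbox`) and the owner's O14-a `Support/RegionSliceCoerciveBox`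
(`sliceCoercive_lev_box`: W1 on boxes at every level) / gen-13 `Support/DirichletStarVectorTower` (`towerLimitRate_star_of_linear`).

 * §1 THE OUTWARD SPIKES `(x,ν)`, `x ∈ Ω`, `x + e_ν ∉ Ω` (`outSet`): the column running BACK into the block from the last `ν`-layer and the
   mirror trace inequality **`trace_outward_le (u) : Σ_{b ∈ outSet} ‖u b‖² ≤ (2·nsq u + Σ_ν nsq (igrad_ν u)) / n`** (any union, any `n ≥ 1`);
 * §2 THE EXTERIOR FLUX LIVES ON THE SPIKES: `extFlux A ≤ 2d·n²·(Σ_{inward} ‖A‖² + Σ_{outward} ‖A‖²)` ((∂ᴴιA)(x), `x ∉ Ω`, sees only the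
   spike bonds at `x`), hence **`extFlux_le_trace : extFlux A ≤ 4d·n·(2·nsq A + Σ_ν nsq (igrad_ν A))`** (any union);
 * (file 2) §3 `gradEnergy_le(_form)`: `Σ_ν ‖∇_ν ιA‖² ≤ (1 + γ′⁻³σ₀⁻⁴γ⁻¹ + 4d·n·(2γ⁻¹ + CgI))·Re⟨A, Δ_a(Ω₀)A⟩` from W1 + interior W2 — LINEAR in `n`
   (the growth `DirichletStarSlabMode.slab_mode_forces_linear_growth` shows unavoidable); §4 on coordinate boxes `hgrad_box` and the END
   `towerLimitRate_star_box_of_compressed` (the COMPRESSED box star tower modulo King's compressed injected law only).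

HONEST FRAMING (T4-DAG p. 1).  [folklore] finite lattice calculus on the cell's typed `U = 1` objects (one region, one averaging scale, finite
torus, operator norm); constants OURS; no hypothesis in this file; the injected law W3 for King's compressed planting NOT proved; Δ1 NOT closed; NE2 (U1a) NOT proved; spine PROVED 0/9 unchanged; NOT [B9] (3.16)/(3.23)–(3.27) as printed;
NOT infinite volume / mass gap / Clay.  HONEST DEPENDENCY: continuum YM on T⁴ ⇐ BetaPertH ∧ nine spine estimates (0/9 proved); BetaPertH
⇐ (D1) ∧ (D4) ∧ CAP+tail; G-an2-4 gates asym, D1 and NE2/3/4.  No `sorry`.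
-/

noncomputable section

open scoped BigOperators ComplexConjugate Matrix Matrix.Norms.L2Operator
open Finset

namespace Summit.QuantumFields.BalabanUV.T4Continuum.RegionStarGradientLinear

open Literature.MathematicalPhysics.QuantumFieldTheory.Balaban1983to89.B5Prop11Plancherel (Tor fine unitVec fdiff)
open Literature.MathematicalPhysics.QuantumFieldTheory.Balaban1983to89.B5Prop11Lower (nsq nsq_nonneg)
open Literature.MathematicalPhysics.QuantumFieldTheory.Balaban1983to89.B5Action121 (GradOp GradOp_conjTranspose_mulVec divS_apply)
open Literature.MathematicalPhysics.QuantumFieldTheory.Balaban1983to89.B5Block118 (bpt tstep tstep_zero tstep_succ)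
open Literature.MathematicalPhysics.QuantumFieldTheory.Balaban1983to89.B5Blocks16 (blockOf blockOf_bpt)
open Literature.MathematicalPhysics.QuantumFieldTheory.Balaban1983to89.B5G183RateUnitTower (lev)
open Literature.MathematicalPhysics.QuantumFieldTheory.Balaban1983to89.B5G183FreeRowSum (fdiff_mulVec)
open Summit.QuantumFields.BalabanUV.T4Continuum
open Summit.QuantumFields.BalabanUV.T4Continuum.CovariantAveragingTower (TowerLimitRate)
open Summit.QuantumFields.BalabanUV.T4Continuum.BackgroundResolventTower (Cpert)
open Summit.QuantumFields.BalabanUV.T4Continuum.BalabanAveragedTowerUnit (cast_lev')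
open Summit.QuantumFields.BalabanUV.T4Continuum.SubtypeCompression (ext ext_apply_of ext_apply_of_not nsq_ext Coercive)
open Summit.QuantumFields.BalabanUV.T4Continuum.ScalarBlockTrialFunction (digits digits_bpt)
open Summit.QuantumFields.BalabanUV.T4Continuum.ScalarAveragedPropagator (gammaPs gammaPs_pos)
open Summit.QuantumFields.BalabanUV.T4Continuum.ScalarAveragedCompression (sigma0 sigma0_pos)
open Summit.QuantumFields.BalabanUV.T4Continuum.RegionGaugeSlice (SliceCoercive)
open Summit.QuantumFields.BalabanUV.T4Continuum.RegionScalarCompression (QOm GOm)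
open Summit.QuantumFields.BalabanUV.T4Continuum.RegionGaugeProjection (gaugeP gaugeR)
open Summit.QuantumFields.BalabanUV.T4Continuum.RegionGaugeFixedVector (starReg curlR gradR avgR regionDeltaA form_regionDeltaA)
open Summit.QuantumFields.BalabanUV.T4Continuum.RegionGaugeFixedVectorFlat (bpt_blockOf_digits)
open Summit.QuantumFields.BalabanUV.T4Continuum.DirichletSubregionTowerOf (pidx QpR JpR)
open Summit.QuantumFields.BalabanUV.T4Continuum.DirichletStarVectorTower (starP digit_eq_of_blockOf_ne gamStar gamStar_pos
  coercive_regionDeltaA_of_slice two_le_lev_succ towerLimitRate_star_of_linear)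
open Summit.QuantumFields.BalabanUV.T4Continuum.DirichletStarRenormTower (igrad)
open Summit.QuantumFields.BalabanUV.T4Continuum.RegionFaceFluxChart (gI gI_nonneg sum_gI_eq gI_eq_of_star)
open Summit.QuantumFields.BalabanUV.T4Continuum.RegionGaffneyIdentity (extFlux extFlux_nonneg gaffney_region)
open Summit.QuantumFields.BalabanUV.T4Continuum.RegionInteriorW2 (CgIbox one_le_CgIbox nsq_eq_add nsq_gaugeP_div_le interiorW2_of_slice)
open Summit.QuantumFields.BalabanUV.T4Continuum.RegionSliceCoerciveBoxTower (cW1box cW1box_pos)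
open Summit.QuantumFields.BalabanUV.T4Continuum.RegionSliceCoerciveBox (sliceCoercive_lev_box)
open Summit.QuantumFields.BalabanUV.T4Continuum.RegionStarTrace (path_avg defSet mem_defSet trace_deficient_le)
open Summit.QuantumFields.BalabanUV.Beta.GAN24.DirichletBoxTrace (blockReg bpt_update_add_tstep bpt_eq_update_add)
open Summit.QuantumFields.BalabanUV.Beta.GAN24.DirichletBoxTwoLevel (IsCoordBox)

/-! ## §1 The outward spikes and their trace inequality -/

section Outward

variable {d : ℕ} (n : ℕ) [NeZero n] (M : Fin d → ℕ) [hM : ∀ μ, NeZero (M μ)] (S : Tor M → Prop) [DecidablePred S]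

/-- the OUTWARD spikes: star bonds `(x,ν)` with `x + e_ν ∉ Ω` (hence `x ∈ Ω`). [folklore] -/
def outSet : Finset {b // starReg n M S b} := univ.filter fun b => ¬ blockReg n M S (b.1.1 + unitVec (fine n M) b.1.2)

/-- membership in `outSet`. [folklore] -/
theorem mem_outSet {b : {b // starReg n M S b}} : b ∈ outSet n M S ↔ ¬ blockReg n M S (b.1.1 + unitVec (fine n M) b.1.2) := by
  simp [outSet]

omit [DecidablePred S] in
/-- an outward spike is based in `Ω`. [folklore] -/
theorem blockReg_of_outward {b : Tor (fine n M) × Fin d} (hb : starReg n M S b) (hx : ¬ blockReg n M S (b.1 + unitVec (fine n M) b.2)) :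
    blockReg n M S b.1 := hb.resolve_right hx

omit [DecidablePred S] in
/-- its base point sits in the LAST `ν`-layer of its block. [folklore] -/
theorem digit_of_outward {b : Tor (fine n M) × Fin d} (hb : starReg n M S b) (hx : ¬ blockReg n M S (b.1 + unitVec (fine n M) b.2)) :
    (digits n M b.1 b.2 : ℕ) + 1 = n := by
  refine digit_eq_of_blockOf_ne n M b.1 b.2 fun h => hx ?_
  have h1 := blockReg_of_outward n M S hb hx
  unfold blockReg at h1 ⊢
  rwa [h]

omit hM in
/-- the bond at depth `s` BELOW the outward spike `b = (x,ν)`: `(x − s·e_ν, ν)`. [folklore] -/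
def opt (b : Tor (fine n M) × Fin d) (s : ℕ) : Tor (fine n M) × Fin d := (b.1 - tstep (fine n M) b.2 s, b.2)

omit [NeZero n] hM in
/-- one step up from depth `s + 1` is depth `s`. [folklore] -/
theorem opt_succ_add (b : Tor (fine n M) × Fin d) (s : ℕ) :
    ((opt n M b (s + 1)).1 + unitVec (fine n M) b.2, b.2) = opt n M b s := by
  unfold opt; rw [tstep_succ, sub_add_eq_sub_sub, sub_add_cancel]

omit [DecidablePred S] in
/-- **THE BACKWARD COLUMN CHART**: depth `s < n` below the spike base is the site of `ν`-digit `n − 1 − s` of the same block. [folklore] -/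
theorem opt_fst_eq {b : Tor (fine n M) × Fin d} (hb : starReg n M S b) (hx : ¬ blockReg n M S (b.1 + unitVec (fine n M) b.2))
    {s : ℕ} (hs : s < n) :
    b.1 - tstep (fine n M) b.2 s = bpt n M (blockOf n M b.1) (Function.update (digits n M b.1) b.2 ⟨n - 1 - s, by omega⟩) := by
  have hdig := digit_of_outward n M S hb hx
  have e0 : b.1 = bpt n M (blockOf n M b.1) (Function.update (digits n M b.1) b.2 0) + tstep (fine n M) b.2 (digits n M b.1 b.2 : ℕ) := by
    conv_lhs => rw [← bpt_blockOf_digits n M b.1]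
    exact bpt_eq_update_add n M _ _ b.2
  rw [← bpt_update_add_tstep n M (blockOf n M b.1) (digits n M b.1) b.2 ⟨n - 1 - s, by omega⟩]
  conv_lhs => rw [e0]
  have e1 : (digits n M b.1 b.2 : ℕ) = (n - 1 - s) + s := by omega
  rw [e1, RegionStarLineGauge.tstep_add, ← add_assoc, add_sub_cancel_right]

omit [DecidablePred S] in
/-- depths `0, …, n − 1` lie in `Ω`. [folklore] -/
theorem blockReg_opt {b : Tor (fine n M) × Fin d} (hb : starReg n M S b) (hx : ¬ blockReg n M S (b.1 + unitVec (fine n M) b.2))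
    {s : ℕ} (hs : s < n) : blockReg n M S (b.1 - tstep (fine n M) b.2 s) := by
  have h1 := blockReg_of_outward n M S hb hx
  unfold blockReg at h1 ⊢
  rwa [opt_fst_eq n M S hb hx hs, blockOf_bpt]

omit [DecidablePred S] in
/-- the `ν`-digit at depth `s` is `n − 1 − s`. [folklore] -/
theorem digit_opt {b : Tor (fine n M) × Fin d} (hb : starReg n M S b) (hx : ¬ blockReg n M S (b.1 + unitVec (fine n M) b.2))
    {s : ℕ} (hs : s < n) : (digits n M (b.1 - tstep (fine n M) b.2 s) b.2 : ℕ) = n - 1 - s := by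
  rw [opt_fst_eq n M S hb hx hs, digits_bpt, Function.update_self]

omit [DecidablePred S] in
/-- **THE BACKWARD COLUMN IS MADE OF STAR BONDS** (depths `< n`). [folklore] -/
theorem star_opt {b : Tor (fine n M) × Fin d} (hb : starReg n M S b) (hx : ¬ blockReg n M S (b.1 + unitVec (fine n M) b.2))
    {s : ℕ} (hs : s < n) : starReg n M S (opt n M b s) :=
  Or.inl (blockReg_opt n M S hb hx hs)

omit [DecidablePred S] in
/-- distinct outward spikes have disjoint backward columns. [folklore] -/
theorem column_inj_out {b b' : Tor (fine n M) × Fin d} (hb : starReg n M S b) (hx : ¬ blockReg n M S (b.1 + unitVec (fine n M) b.2))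
    (hb' : starReg n M S b') (hx' : ¬ blockReg n M S (b'.1 + unitVec (fine n M) b'.2)) {s s' : ℕ} (hs : s < n) (hs' : s' < n)
    (h : opt n M b s = opt n M b' s') : b = b' ∧ s = s' := by
  obtain ⟨h1, h2⟩ := Prod.mk.inj h
  have hd := digit_opt n M S hb hx hs
  have hd' := digit_opt n M S hb' hx' hs'
  rw [h1, h2, hd'] at hd
  have hss : s = s' := by omega
  subst hss
  rw [h2] at h1
  exact ⟨Prod.ext (sub_left_injective h1) h2, rfl⟩

/-- **ONE OUTWARD SPIKE**: `n·‖u b‖² ≤ 2·Σ_{s<n} ‖ιu (x − s e_ν, ν)‖² + Σ_{s<n} gI_ν u (x − s e_ν, ν)`. [folklore] -/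
theorem spike_out_le (u : {b // starReg n M S b} → ℂ) (b : {b // starReg n M S b})
    (hx : ¬ blockReg n M S (b.1.1 + unitVec (fine n M) b.1.2)) :
    (n : ℝ) * ‖u b‖ ^ 2 ≤ 2 * ∑ s ∈ range n, ‖ext (starReg n M S) u (opt n M b.1 s)‖ ^ 2
      + ∑ s ∈ range n, gI n M S b.1.2 u (opt n M b.1 s) := by
  have hp := path_avg (fun s => ext (starReg n M S) u (opt n M b.1 s)) n
  have h0 : ext (starReg n M S) u (opt n M b.1 0) = u b := by
    have e : opt n M b.1 0 = b.1 := by unfold opt; rw [tstep_zero, sub_zero]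
    rw [e]; exact ext_apply_of _ u b
  simp only [h0] at hp
  -- the difference between depths `r` and `r + 1` is the interior difference AT depth `r + 1`
  have hdiff : ∀ r ∈ range (n - 1), (n : ℝ) ^ 2 * ‖ext (starReg n M S) u (opt n M b.1 (r + 1)) - ext (starReg n M S) u (opt n M b.1 r)‖ ^ 2
      = gI n M S b.1.2 u (opt n M b.1 (r + 1)) := by
    intro r hr
    have hr' : r + 1 < n := by have := mem_range.mp hr; omega
    have hc : starReg n M S (opt n M b.1 (r + 1)) := star_opt n M S b.2 hx hr'
    have hc' : starReg n M S ((opt n M b.1 (r + 1)).1 + unitVec (fine n M) b.1.2, (opt n M b.1 (r + 1)).2) := by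
      have e : ((opt n M b.1 (r + 1)).1 + unitVec (fine n M) b.1.2, (opt n M b.1 (r + 1)).2) = opt n M b.1 r := opt_succ_add n M b.1 r
      rw [e]; exact star_opt n M S b.2 hx (by omega)
    rw [gI_eq_of_star n M S b.1.2 u _ hc hc', norm_sub_rev]
    have e : ((opt n M b.1 (r + 1)).1 + unitVec (fine n M) b.1.2, (opt n M b.1 (r + 1)).2) = opt n M b.1 r := opt_succ_add n M b.1 r
    rw [e]
  have hsum : (n : ℝ) ^ 2 * ∑ r ∈ range (n - 1), ‖ext (starReg n M S) u (opt n M b.1 (r + 1)) - ext (starReg n M S) u (opt n M b.1 r)‖ ^ 2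
      ≤ ∑ s ∈ range n, gI n M S b.1.2 u (opt n M b.1 s) := by
    rw [mul_sum, sum_congr rfl hdiff]
    have hsub : ∑ r ∈ range (n - 1), gI n M S b.1.2 u (opt n M b.1 (r + 1))
        = ∑ s ∈ (range (n - 1)).map ⟨fun r => r + 1, add_left_injective 1⟩, gI n M S b.1.2 u (opt n M b.1 s) := by
      rw [sum_map]; rfl
    rw [hsub]
    refine sum_le_sum_of_subset_of_nonneg ?_ fun _ _ _ => gI_nonneg n M S _ u _
    intro s hs
    rw [mem_map] at hs
    obtain ⟨r, hr, rfl⟩ := hs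
    have := mem_range.mp hr
    exact mem_range.mpr (by simp only [Function.Embedding.coeFn_mk]; omega)
  linarith

/-- injectivity of the backward columns on `outSet × range n`. [folklore] -/
theorem opt_injOn : Set.InjOn (fun p : {b // starReg n M S b} × ℕ => opt n M p.1.1 p.2) ↑(outSet n M S ×ˢ range n) := by
  rintro ⟨b, s⟩ hbs ⟨b', s'⟩ hbs' h
  rw [Finset.coe_product, Set.mem_prod, Finset.mem_coe, mem_outSet, Finset.mem_coe, mem_range] at hbs hbs'
  obtain ⟨h1, h2⟩ := column_inj_out n M S b.2 hbs.1 b'.2 hbs'.1 hbs.2 hbs'.2 h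
  exact Prod.ext (Subtype.ext h1) h2

/-- summing a non-negative bond function over the backward columns of all outward spikes counts every bond at most once. [folklore] -/
theorem sum_columns_out_le (F : Tor (fine n M) × Fin d → ℝ) (hF : ∀ c, 0 ≤ F c) :
    ∑ b ∈ outSet n M S, ∑ s ∈ range n, F (opt n M b.1 s) ≤ ∑ c, F c := by
  rw [← sum_product (s := outSet n M S) (t := range n) (f := fun p => F (opt n M p.1.1 p.2)),
    ← sum_image (f := F) (g := fun p : {b // starReg n M S b} × ℕ => opt n M p.1.1 p.2) (opt_injOn n M S)]
  exact sum_le_sum_of_subset_of_nonneg (subset_univ _) fun c _ _ => hF c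

/-- **THE TRACE INEQUALITY ON THE OUTWARD SPIKES**: `Σ_{b ∈ outSet} ‖u b‖² ≤ (2·nsq u + Σ_ν nsq (igrad_ν u)) / n` (any union, any `n ≥ 1`).
[folklore] -/
theorem trace_outward_le (u : {b // starReg n M S b} → ℂ) :
    ∑ b ∈ outSet n M S, ‖u b‖ ^ 2 ≤ (2 * nsq u + ∑ ν, nsq (igrad M S n ν u)) / n := by
  have hn : (0 : ℝ) < n := by exact_mod_cast Nat.pos_of_ne_zero (NeZero.ne n)
  rw [le_div_iff₀ hn, sum_mul]
  have h1 : ∑ b ∈ outSet n M S, ‖u b‖ ^ 2 * n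
      ≤ ∑ b ∈ outSet n M S, (2 * ∑ s ∈ range n, ‖ext (starReg n M S) u (opt n M b.1 s)‖ ^ 2
          + ∑ s ∈ range n, gI n M S b.1.2 u (opt n M b.1 s)) :=
    sum_le_sum fun b hb => by rw [mul_comm]; exact spike_out_le n M S u b ((mem_outSet n M S).mp hb)
  have h2 : ∑ b ∈ outSet n M S, ∑ s ∈ range n, ‖ext (starReg n M S) u (opt n M b.1 s)‖ ^ 2 ≤ nsq u := by
    rw [← nsq_ext (starReg n M S) u]
    exact sum_columns_out_le n M S (fun c => ‖ext (starReg n M S) u c‖ ^ 2) fun c => by positivity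
  have h3 : ∑ b ∈ outSet n M S, ∑ s ∈ range n, gI n M S b.1.2 u (opt n M b.1 s) ≤ ∑ ν, nsq (igrad M S n ν u) := by
    have h3a := sum_columns_out_le n M S (fun c => gI n M S c.2 u c) fun c => gI_nonneg n M S _ u _
    have h3b : ∑ c : Tor (fine n M) × Fin d, gI n M S c.2 u c ≤ ∑ c : Tor (fine n M) × Fin d, ∑ ν, gI n M S ν u c :=
      sum_le_sum fun c _ => single_le_sum (f := fun ν => gI n M S ν u c) (fun ν _ => gI_nonneg n M S ν u c) (mem_univ c.2)
    rw [sum_comm] at h3b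
    simp only [sum_gI_eq] at h3b
    exact h3a.trans h3b
  rw [sum_add_distrib, ← mul_sum] at h1
  linarith

end Outward

/-! ## §2 The exterior flux lives on the spikes -/

section Flux

variable {d : ℕ} (n : ℕ) [NeZero n] (M : Fin d → ℕ) [hM : ∀ μ, NeZero (M μ)] (S : Tor M → Prop) [DecidablePred S]

/-- a subtype sum over the exterior sites as an indicator sum. [folklore] -/
theorem sum_exterior_eq (h : Tor (fine n M) → ℝ) :
    ∑ x : {x // ¬ blockReg n M S x}, h x.1 = ∑ x, (if blockReg n M S x then 0 else h x) := by
  rw [← Fintype.sum_subtype_add_sum_subtype (blockReg n M S) (fun x => if blockReg n M S x then 0 else h x)]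
  have h0 : ∑ x : {x // blockReg n M S x}, (if blockReg n M S x.1 then 0 else h x.1) = 0 :=
    sum_eq_zero fun x _ => if_pos x.2
  rw [h0, zero_add]
  exact sum_congr rfl fun x _ => (if_neg x.2).symm

/-- the INWARD spike mass read on all bonds: `Σ_x [x ∉ Ω]·Σ_μ ‖ιA(x,μ)‖² = Σ_{defSet} ‖A‖²`. [folklore] -/
theorem sum_inward_eq (A : {b // starReg n M S b} → ℂ) :
    ∑ x, (if blockReg n M S x then 0 else ∑ μ, ‖ext (starReg n M S) A (x, μ)‖ ^ 2) = ∑ b ∈ defSet n M S, ‖A b‖ ^ 2 := by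
  set g : Tor (fine n M) × Fin d → ℝ := fun c => if blockReg n M S c.1 then 0 else ‖ext (starReg n M S) A c‖ ^ 2 with hg
  have hL : ∑ x, (if blockReg n M S x then 0 else ∑ μ, ‖ext (starReg n M S) A (x, μ)‖ ^ 2) = ∑ c, g c := by
    rw [Fintype.sum_prod_type]
    refine sum_congr rfl fun x _ => ?_
    by_cases hx : blockReg n M S x
    · rw [if_pos hx]; exact (sum_eq_zero fun μ _ => by simp only [hg, if_pos hx]).symm
    · rw [if_neg hx]; exact sum_congr rfl fun μ _ => by simp only [hg, if_neg hx]
  rw [hL, ← Fintype.sum_subtype_add_sum_subtype (starReg n M S) g]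
  have h0 : ∑ c : {c // ¬ starReg n M S c}, g c.1 = 0 := sum_eq_zero fun c _ => by
    simp only [hg]; split_ifs
    · rfl
    · rw [ext_apply_of_not _ _ c.2, norm_zero, zero_pow two_ne_zero]
  rw [h0, add_zero, defSet, sum_filter]
  refine sum_congr rfl fun b _ => ?_
  simp only [hg]
  by_cases hb : blockReg n M S b.1.1
  · rw [if_pos hb, if_neg (not_not_intro hb)]
  · rw [if_neg hb, if_pos hb, ext_apply_of]

/-- the OUTWARD spike mass read on all bonds: `Σ_x [x ∉ Ω]·Σ_μ ‖ιA(x − e_μ, μ)‖² = Σ_{outSet} ‖A‖²`. [folklore] -/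
theorem sum_outward_eq (A : {b // starReg n M S b} → ℂ) :
    ∑ x, (if blockReg n M S x then 0 else ∑ μ, ‖ext (starReg n M S) A (x - unitVec (fine n M) μ, μ)‖ ^ 2)
      = ∑ b ∈ outSet n M S, ‖A b‖ ^ 2 := by
  set g : Tor (fine n M) × Fin d → ℝ := fun c =>
    if blockReg n M S (c.1 + unitVec (fine n M) c.2) then 0 else ‖ext (starReg n M S) A c‖ ^ 2 with hg
  -- reindex `x = z + e_μ` direction by direction
  have hμ : ∀ μ : Fin d, ∑ x, (if blockReg n M S x then 0 else ‖ext (starReg n M S) A (x - unitVec (fine n M) μ, μ)‖ ^ 2)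
      = ∑ z, g (z, μ) := fun μ =>
    Fintype.sum_equiv (Equiv.subRight (unitVec (fine n M) μ)) _ _ fun x => by
      simp only [hg, Equiv.subRight_apply, sub_add_cancel]
  have hL : ∑ x, (if blockReg n M S x then 0 else ∑ μ, ‖ext (starReg n M S) A (x - unitVec (fine n M) μ, μ)‖ ^ 2) = ∑ c, g c := by
    have e1 : ∑ x, (if blockReg n M S x then 0 else ∑ μ, ‖ext (starReg n M S) A (x - unitVec (fine n M) μ, μ)‖ ^ 2)
        = ∑ x, ∑ μ, (if blockReg n M S x then 0 else ‖ext (starReg n M S) A (x - unitVec (fine n M) μ, μ)‖ ^ 2) := by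
      refine sum_congr rfl fun x _ => ?_
      split_ifs
      · exact (sum_const_zero).symm
      · rfl
    rw [e1, sum_comm, sum_congr rfl fun μ _ => hμ μ, sum_comm, Fintype.sum_prod_type]
  rw [hL, ← Fintype.sum_subtype_add_sum_subtype (starReg n M S) g]
  have h0 : ∑ c : {c // ¬ starReg n M S c}, g c.1 = 0 := sum_eq_zero fun c _ => by
    simp only [hg]; split_ifs
    · rfl
    · rw [ext_apply_of_not _ _ c.2, norm_zero, zero_pow two_ne_zero]
  rw [h0, add_zero, outSet, sum_filter]
  refine sum_congr rfl fun b _ => ?_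
  simp only [hg]
  by_cases hb : blockReg n M S (b.1.1 + unitVec (fine n M) b.1.2)
  · rw [if_pos hb, if_neg (not_not_intro hb)]
  · rw [if_neg hb, if_pos hb, ext_apply_of]

/-- the divergence of the zero-extension at ONE exterior site: `‖(∂ᴴιA)(x)‖² ≤ 2d·n²·Σ_μ (‖ιA(x − e_μ,μ)‖² + ‖ιA(x,μ)‖²)`. [folklore] -/
theorem norm_div_ext_sq_le (A : {b // starReg n M S b} → ℂ) (x : Tor (fine n M)) :
    ‖((GradOp (fine n M) (n : ℂ))ᴴ *ᵥ ext (starReg n M S) A) x‖ ^ 2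
      ≤ 2 * d * (n : ℝ) ^ 2 * ∑ μ, (‖ext (starReg n M S) A (x - unitVec (fine n M) μ, μ)‖ ^ 2 + ‖ext (starReg n M S) A (x, μ)‖ ^ 2) := by
  set p : Fin d → ℝ := fun μ => ‖ext (starReg n M S) A (x - unitVec (fine n M) μ, μ)‖ with hp
  set q : Fin d → ℝ := fun μ => ‖ext (starReg n M S) A (x, μ)‖ with hq
  rw [GradOp_conjTranspose_mulVec, divS_apply]
  have h1 : ‖∑ μ, (starRingEnd ℂ) (n : ℂ) * (ext (starReg n M S) A (x - unitVec (fine n M) μ, μ) - ext (starReg n M S) A (x, μ))‖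
      ≤ ∑ μ, (n : ℝ) * (p μ + q μ) := by
    refine (norm_sum_le _ _).trans (sum_le_sum fun μ _ => ?_)
    rw [norm_mul, Complex.norm_conj, Complex.norm_natCast]
    exact mul_le_mul_of_nonneg_left (norm_sub_le _ _) (Nat.cast_nonneg n)
  have h2 : (∑ μ, (n : ℝ) * (p μ + q μ)) ^ 2 ≤ d * ∑ μ, ((n : ℝ) * (p μ + q μ)) ^ 2 := by
    have := sq_sum_le_card_mul_sum_sq (s := (univ : Finset (Fin d))) (f := fun μ => (n : ℝ) * (p μ + q μ))
    rwa [card_univ, Fintype.card_fin] at this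
  have h3 : ∑ μ, ((n : ℝ) * (p μ + q μ)) ^ 2 ≤ ∑ μ, 2 * (n : ℝ) ^ 2 * (p μ ^ 2 + q μ ^ 2) :=
    sum_le_sum fun μ _ => by nlinarith [sq_nonneg (p μ - q μ)]
  have h0 : 0 ≤ ∑ μ, (n : ℝ) * (p μ + q μ) := sum_nonneg fun μ _ => by positivity
  calc _ ≤ (∑ μ, (n : ℝ) * (p μ + q μ)) ^ 2 := pow_le_pow_left₀ (norm_nonneg _) h1 2
    _ ≤ d * ∑ μ, 2 * (n : ℝ) ^ 2 * (p μ ^ 2 + q μ ^ 2) := h2.trans (mul_le_mul_of_nonneg_left h3 (Nat.cast_nonneg d))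
    _ = 2 * d * (n : ℝ) ^ 2 * ∑ μ, (p μ ^ 2 + q μ ^ 2) := by rw [← mul_sum]; ring

/-- **THE EXTERIOR FLUX LIVES ON THE SPIKES**: `extFlux A ≤ 2d·n²·(Σ_{inward spikes} ‖A‖² + Σ_{outward spikes} ‖A‖²)`. [folklore] -/
theorem extFlux_le_spikes (A : {b // starReg n M S b} → ℂ) :
    extFlux n M S A ≤ 2 * d * (n : ℝ) ^ 2 * (∑ b ∈ defSet n M S, ‖A b‖ ^ 2 + ∑ b ∈ outSet n M S, ‖A b‖ ^ 2) := by
  rw [show extFlux n M S A = ∑ x, (if blockReg n M S x then 0 else ‖((GradOp (fine n M) (n : ℂ))ᴴ *ᵥ ext (starReg n M S) A) x‖ ^ 2)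
      from by unfold extFlux; exact sum_exterior_eq n M S (fun x => ‖((GradOp (fine n M) (n : ℂ))ᴴ *ᵥ ext (starReg n M S) A) x‖ ^ 2), ← sum_inward_eq n M S A, ← sum_outward_eq n M S A, ← sum_add_distrib, mul_sum]
  refine sum_le_sum fun x _ => ?_
  by_cases hx : blockReg n M S x
  · simp only [if_pos hx, add_zero, mul_zero, le_refl]
  · simp only [if_neg hx]
    rw [← sum_add_distrib]
    refine (norm_div_ext_sq_le n M S A x).trans (le_of_eq ?_)
    congr 1
    exact sum_congr rfl fun μ _ => add_comm _ _

/-- **`extFlux A ≤ 4d·n·(2·nsq A + Σ_ν nsq (igrad_ν A))`** — both spike families obey the trace inequality. [folklore] -/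
theorem extFlux_le_trace (A : {b // starReg n M S b} → ℂ) :
    extFlux n M S A ≤ 4 * d * (n : ℝ) * (2 * nsq A + ∑ ν, nsq (igrad M S n ν A)) := by
  have hn : (0 : ℝ) < n := by exact_mod_cast Nat.pos_of_ne_zero (NeZero.ne n)
  have hT := trace_deficient_le n M S A
  have hO := trace_outward_le n M S A
  have hK : 0 ≤ 2 * nsq A + ∑ ν, nsq (igrad M S n ν A) := by
    have := nsq_nonneg A; have := sum_nonneg fun ν (_ : ν ∈ univ) => nsq_nonneg (igrad M S n ν A); positivity
  calc extFlux n M S A ≤ 2 * d * (n : ℝ) ^ 2 * (∑ b ∈ defSet n M S, ‖A b‖ ^ 2 + ∑ b ∈ outSet n M S, ‖A b‖ ^ 2) :=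
        extFlux_le_spikes n M S A
    _ ≤ 2 * d * (n : ℝ) ^ 2 * (2 * ((2 * nsq A + ∑ ν, nsq (igrad M S n ν A)) / n)) := by
        refine mul_le_mul_of_nonneg_left (by linarith) (by positivity)
    _ = 4 * d * (n : ℝ) * (2 * nsq A + ∑ ν, nsq (igrad M S n ν A)) := by field_simp; ring

end Flux

end Summit.QuantumFields.BalabanUV.T4Continuum.RegionStarGradientLinear

end
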